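/-
Copyright (c) 2026 the pub-hodgecm-mathlib formalisation cell (harness21).  Prover seat hodgecm-mathlib-K2E3-p14 (g9), Track B «K2-LIT» ∕ h413 =
`stmt-HodgeConjecture-24833`, line `K2_E3_EllipticInputs`, unit U4 «Keys», PART «U4Keys» socket :182 (U4f-χ₁-ram-one-pos), programme A_pos^{<}
(default offer BY NAME on the K2 bus 2026-09-04T22:09:54Z after ★ p862387, LINE-LEAD K2E3-plan ∕ chair K2-lead VALVE): brick (v)-θ^{<} «THE CHARACTER `j ↦ χ₁(j₀₀)`
OF A TWO-DEPTH LEVEL GROUP `J_{r,s;r',s'}` OF `U(σ, Φ₃)(K)`» — the two-depth twin of ★ `K2E3LevelNIwahoriCharacter` (K2E3-p37 (g0), uniform depth `n`).  REPORT-FIRST 2026-09-04.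
-/
import Summits.HodgeConjecture.HodgeConjecture.Theorems.K2E3IwahoriTwoDepthFactorisation   -- ★ p862387 (this seat): `test_twoDepth_iff`, pivot `v_apply_zero_zero_eq_one_of_mem`, `v_uniformiser_le_one`
import Summits.HodgeConjecture.HodgeConjecture.Theorems.K2E3LevelNIwahoriCharacter       -- ★ p861832 (K2E3-p37): `chi_mk0_eq_mul_of_v_sub_le_pow` (conductor-`≤ n` characters modulo `𝔭ⁿ`)
import HarnessLib

/-!
# K2 ∕ E3 «EllipticInputs», unit U4 «Keys» — (U4f-χ₁-ram-one-pos), programme A_pos^{<} brick (v)-θ^{<}: THE CHARACTER `j ↦ χ₁(j₀₀)` OF A TWO-DEPTH LEVEL GROUP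
# `J_{r,s;r',s'} ≤ U(σ, Φ₃)(K)` «multiplicative as soon as `r + r' ≥ n`, `s + 2r' ≥ n`, `2r + s' ≥ n` and `s + s' ≥ c`, for `χ₁` trivial on `1 + 𝔭ⁿ` and on the `σ`-FIXED part
# of `1 + 𝔭ᶜ`»   [Roche1998 §3 Lemma 3.2; MoyPrasad1996 §3; BruhatTits1972 §6.4; Casselman1995 §1.4]

Cell hodgecm-mathlib, Track B «K2-LIT», crux item H413 = stmt-HodgeConjecture-24833 (route `HCCMUnconditional`, no route verbs); serves BY NAME the OPEN tier-0 leaf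
`…K2E3EllipticInputs.U4Keys.sig_K2E3KeysThmTwoContractingRamifiedCharOnePosDepth` (U4Keys :182), design D-I at POSITIVE depth in the regime A_pos^{<} (`c_F = cond χ₁|_{F^×} <
n = cond χ₁`; K2E3-p37 (g0) memo §9).  Author K2E3-p14 (g9).  `--supports stmt-HodgeConjecture-24833 --as helper`; THEOREMS ONLY (no `def` ∕ `instance` ∕ `notation` ∕
named fact ∕ `sorry`); MODEL level (`U(σ, Φ₃)(K)`; letters `σ hJ hσ hvσ hvϖ` of ★ and `(Jg, hJg)` of ★ p862387 at the two-depth exponent matrix).  NOT THE PAYER of :182.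

THE POINT.  ★ p861832 reads the type character off the `(0,0)` entry on the uniform `J_n` (all lower entries in `𝔭ⁿ`), where `(jj′)₀₀ − j₀₀j′₀₀ = j₀₁j′₁₀ + j₀₂j′₂₀ ∈ 𝔭ⁿ`.  On
Roche's asymmetric group `J = J_{r,s;r',s'}` (★ p862387: `y`-entries `(0,1),(1,2) ∈ 𝔭ʳ`, `b`-entry `(0,2) ∈ 𝔭ˢ`, `x`-entries `(1,0),(2,1) ∈ 𝔭^{r'}`, `z`-entry `(2,0) ∈ 𝔭^{s'}`) the
long-root term `j₀₂j′₂₀` lies only in `𝔭^{s+s'}`, and `s + s' < n` is the whole point of A_pos^{<}.  What saves `θ(j) := χ₁(j₀₀)` is the HERMITIAN structure: normalising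
`j₀ = a(1, y, b)` (row) and `j′e₀ = a′(1, x, z)ᵀ` (column), the isotropy of rows and columns gives `b + σb = -yσy ∈ 𝔭^{2r}` and `z + σz = -xσx ∈ 𝔭^{2r'}` — `b` and `z` are
«imaginary to high order» — so with a TRACE-ONE element `t` (`t + σt = 1`, `|t| ≤ 1`; `t = 1∕2` when `|2| = 1`, available at every unramified dyadic place too)
  `(jj′)₀₀ = a·a′·(1 + W) + a·a′·E`,  `W := t·bz + σ(t·bz)` `σ`-FIXED with `|W| ≤ |ϖ|^{s+s'}`,  `E := yx − σt·(yσy·xσx + yσy·z + b·xσx)`, `|E| ≤ |ϖ|^{min(r+r', 2r+s', s+2r')}`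
(§2, a ring identity from the two isotropy relations and `t + σt = 1`).  Hence (§3) `χ₁((jj′)₀₀) = χ₁(a)χ₁(a′)χ₁(1 + W) = χ₁(a)χ₁(a′)` as soon as `χ₁ = 1` on `{u : |u − 1| ≤ |ϖ|ⁿ}`
(`hcond`, conductor `≤ n`) with `n ≤ r + r'`, `n ≤ 2r + s'`, `n ≤ s + 2r'`, and `χ₁ = 1` on the `σ`-FIXED `u` with `|u − 1| ≤ |ϖ|ᶜ` (`hcondF`, the conductor of `χ₁|_F` in
`E`-normalised exponent) with `c ≤ s + s'`.  Check on the two shapes of the census: p37 §9's `(n−c, 0, c, c)` needs `2c ≥ n` (the condition `n ≤ s + 2r'`); for `2c ≤ n` the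
concave shape `(n−c, n−2c, c, c)` passes all four — uniformly `s := (n − 2c)⁺`; ★ p861832's `J_n` is `(0, 0, n, n)` with `hcondF` vacuous (`c := n`... there `s + s' = n`).
* §1 `apply_zero_zero_mul_eq` (`(jj′)₀₀ = j₀₀j′₀₀ + j₀₁j′₁₀ + j₀₂j′₂₀`), `row_zero_isotropic` (`j₀₀σj₀₂ + j₀₁σj₀₁ + j₀₂σj₀₀ = 0`), `apply_zero_zero_ne_zero_of_mem`.
* §2 **`exists_fixed_add_small_of_mem`**: the decomposition `(jj′)₀₀ = j₀₀j′₀₀(1 + W) + j₀₀j′₀₀E` with `σW = W`, `|W| ≤ |ϖ|^{s+s'}`, `|E| ≤ |ϖ|ⁿ`.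
* §3 **`chi_apply_zero_zero_mul_twoDepth`** (trace-one letter `t`), `chi_apply_zero_zero_mul_twoDepth_of_v_two` (`|2| = 1`, `t = 2⁻¹`).
HONEST LABEL: HC_CM is proved only modulo the 7 printed citations (2 remaining named inputs: hLiu418 = stmt-HodgeConjecture-24832, h413 = stmt-HodgeConjecture-24833)
until rung 0 closes; count-neutral — this file does NOT pay the leaf; no printed citation is discharged.

## References
* [Roche1998] A. Roche, *Types and Hecke algebras for principal series representations of split reductive p-adic groups*, Ann. Sci. ÉNS (4) 31 (1998), §3, Lemma 3.2 (`χ̃` on `J_χ`).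
* [MoyPrasad1996] A. Moy, G. Prasad, *Jacquet functors and unrefined minimal K-types*, Comment. Math. Helv. 71 (1996), §3.
* [BruhatTits1972] F. Bruhat, J. Tits, *Groupes réductifs sur un corps local I*, Publ. Math. IHÉS 41 (1972), §6.4, (4.4.4).
* [Casselman1995] W. Casselman, *Introduction to the theory of admissible representations of `p`-adic reductive groups* (1995), §1.4.
* [Rogawski1990] J. D. Rogawski, *Automorphic Representations of Unitary Groups in Three Variables* (1990), §1.9 p. 8 (the Hermitian relations).
-/

set_option autoImplicit false
-- the mandated namespace repeats the single-problem summit's segment (`HodgeConjecture.HodgeConjecture`)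
set_option linter.dupNamespace false

noncomputable section

open Matrix Literature.NumberTheory.Automorphic Literature.NumberTheory.Automorphic.UnitaryGroup
open scoped Matrix MatrixGroups WithZero

namespace Summit.HodgeConjecture.HodgeConjecture.Cruxes.H413.K2E3TwoDepthIwahoriCharacter

open Summit.HodgeConjecture.HodgeConjecture.Cruxes.H413

variable {K : Type*} [Field K] [Valued K ℤᵐ⁰] [ValuativeRel K] [(Valued.v : Valuation K ℤᵐ⁰).Compatible]
  (σ : K →+* K) {ϖ : K} {J : Matrix (Fin 3) (Fin 3) K} (hJ : J = (StdForm.antidiagonal 3).over K)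
  (hσ : ∀ a, σ (σ a) = a) (hvσ : ∀ a, Valued.v (σ a) = Valued.v a) (hvϖ : Valued.v ϖ = WithZero.exp (-1 : ℤ))
  {r s r' s' : ℕ} (Jg : Subgroup ↥(unitaryGroupOfForm σ J))
  (hJg : ∀ k, k ∈ Jg ↔ ∀ i j, Valued.v (((k : GL (Fin 3) K) : Matrix (Fin 3) (Fin 3) K) i j) ≤
    Valued.v ϖ ^ (![![0, r, s], ![r', 0, r], ![s', r', 0]] : Fin 3 → Fin 3 → ℕ) i j)

/-! ## §1 The `(0,0)` entry of a product; the isotropy of the first row -/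

omit [Valued K ℤᵐ⁰] [ValuativeRel K] [(Valued.v : Valuation K ℤᵐ⁰).Compatible] in
/-- `(j j′)₀₀ = j₀₀j′₀₀ + j₀₁j′₁₀ + j₀₂j′₂₀`. [cite: Rogawski1990, §1.9 p. 8] -/
theorem apply_zero_zero_mul_eq (j j' : ↥(unitaryGroupOfForm σ J)) :
    (((j * j' : ↥(unitaryGroupOfForm σ J)) : GL (Fin 3) K) : Matrix (Fin 3) (Fin 3) K) 0 0 =
      (((j : GL (Fin 3) K) : Matrix (Fin 3) (Fin 3) K) 0 0) * (((j' : GL (Fin 3) K) : Matrix (Fin 3) (Fin 3) K) 0 0) +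
        (((j : GL (Fin 3) K) : Matrix (Fin 3) (Fin 3) K) 0 1) * (((j' : GL (Fin 3) K) : Matrix (Fin 3) (Fin 3) K) 1 0) +
        (((j : GL (Fin 3) K) : Matrix (Fin 3) (Fin 3) K) 0 2) * (((j' : GL (Fin 3) K) : Matrix (Fin 3) (Fin 3) K) 2 0) := by
  rw [Subgroup.coe_mul, Units.val_mul, Matrix.mul_apply, Fin.sum_univ_three]

omit [Valued K ℤᵐ⁰] [ValuativeRel K] [(Valued.v : Valuation K ℤᵐ⁰).Compatible] in
include hJ hσ in
/-- **The first ROW of `j ∈ U(σ, Φ₃)` is isotropic**: `j₀₀σ(j₀₂) + j₀₁σ(j₀₁) + j₀₂σ(j₀₀) = 0` — the column-`2` relation of ★ `sum_rel_of_mem` for `j⁻¹`, whose column `2` is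
`(σj₀₂, σj₀₁, σj₀₀)ᵀ` (★ `coe_inv_apply_eq`). [cite: Rogawski1990, §1.9 p. 8] -/
theorem row_zero_isotropic (j : ↥(unitaryGroupOfForm σ J)) :
    (((j : GL (Fin 3) K) : Matrix (Fin 3) (Fin 3) K) 0 0) * σ (((j : GL (Fin 3) K) : Matrix (Fin 3) (Fin 3) K) 0 2) +
      (((j : GL (Fin 3) K) : Matrix (Fin 3) (Fin 3) K) 0 1) * σ (((j : GL (Fin 3) K) : Matrix (Fin 3) (Fin 3) K) 0 1) +
      (((j : GL (Fin 3) K) : Matrix (Fin 3) (Fin 3) K) 0 2) * σ (((j : GL (Fin 3) K) : Matrix (Fin 3) (Fin 3) K) 0 0) = 0 := by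
  have h := sum_rel_of_mem σ hJ (j⁻¹) 2 2
  have r0 : Fin.rev (0 : Fin 3) = 2 := rfl
  have r1 : Fin.rev (1 : Fin 3) = 1 := rfl
  have r2 : Fin.rev (2 : Fin 3) = 0 := rfl
  simp only [Fin.sum_univ_three, r0, r1, r2, coe_inv_apply_eq σ hJ j, hσ, Fin.isValue, show (2 : Fin 3) ≠ 0 by decide, if_false] at h
  linear_combination h

include hJ hvσ hvϖ hJg in
/-- The `(0,0)` entry of an element of `J_{r,s;r',s'}` with `1 ≤ r'`, `1 ≤ s'` is non-zero (it is a unit, ★ `v_apply_zero_zero_eq_one_of_mem`). [cite: BruhatTits1972, (4.4.4)] -/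
theorem apply_zero_zero_ne_zero_of_mem (hr'1 : 1 ≤ r') (hs'1 : 1 ≤ s') {j : ↥(unitaryGroupOfForm σ J)} (hj : j ∈ Jg) :
    (((j : GL (Fin 3) K) : Matrix (Fin 3) (Fin 3) K) 0 0) ≠ 0 := by
  intro h
  have hv := K2E3IwahoriTwoDepthFactorisation.v_apply_zero_zero_eq_one_of_mem σ hJ hvσ hvϖ _ Jg hJg (by simpa using hr'1) (by simpa using hs'1) hj
  rw [h, map_zero] at hv
  exact zero_ne_one hv

/-! ## §2 The decomposition `(jj′)₀₀ = j₀₀j′₀₀·(1 + W) + j₀₀j′₀₀·E`, `W` `σ`-fixed in `𝔭^{s+s'}`, `E ∈ 𝔭ⁿ` -/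

include hJ hσ hvσ hvϖ hJg in
/-- **THE HERMITIAN SPLITTING OF THE `(0,0)` COCYCLE ON `J_{r,s;r',s'}`.**  For `j, j′ ∈ J` (`1 ≤ r'`, `1 ≤ s'`), a trace-one `t` (`t + σt = 1`, `|t| ≤ 1`) and `n` with
`n ≤ r + r'`, `n ≤ 2r + s'`, `n ≤ s + 2r'`: there are `W, E ∈ K` with `σW = W`, `|W| ≤ |ϖ|^{s+s'}`, `|E| ≤ |ϖ|ⁿ` and `(jj′)₀₀ = j₀₀j′₀₀(1 + W) + j₀₀j′₀₀E`.  Proof: normalise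
`j₀ = a(1, y, b)`, `j′e₀ = a′(1, x, z)ᵀ` (`|a| = |a′| = 1` ★ pivot; `|y| ≤ |ϖ|ʳ`, `|b| ≤ |ϖ|ˢ`, `|x| ≤ |ϖ|^{r'}`, `|z| ≤ |ϖ|^{s'}` by the test); row ∕ column isotropy give
`σb = −yσy − b`, `σz = −xσx − z`; put `W := t·bz + σ(t·bz)`, `E := yx − σt(yσy·xσx + yσy·z + b·xσx)`; then `1 + yx + bz = (1 + W) + E` identically.
[cite: Roche1998, §3, Lemma 3.2] [cite: BruhatTits1972, §6.4] [cite: Rogawski1990, §1.9 p. 8] -/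
theorem exists_fixed_add_small_of_mem (hr'1 : 1 ≤ r') (hs'1 : 1 ≤ s') {n : ℕ} (hn1 : n ≤ r + r') (hn2 : n ≤ 2 * r + s') (hn3 : n ≤ s + 2 * r')
    (t : K) (ht : t + σ t = 1) (hvt : Valued.v t ≤ 1) {j j' : ↥(unitaryGroupOfForm σ J)} (hj : j ∈ Jg) (hj' : j' ∈ Jg) :
    ∃ W E : K, σ W = W ∧ Valued.v W ≤ Valued.v ϖ ^ (s + s') ∧ Valued.v E ≤ Valued.v ϖ ^ n ∧
      (((j * j' : ↥(unitaryGroupOfForm σ J)) : GL (Fin 3) K) : Matrix (Fin 3) (Fin 3) K) 0 0 =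
        (((j : GL (Fin 3) K) : Matrix (Fin 3) (Fin 3) K) 0 0) * (((j' : GL (Fin 3) K) : Matrix (Fin 3) (Fin 3) K) 0 0) * (1 + W) +
          (((j : GL (Fin 3) K) : Matrix (Fin 3) (Fin 3) K) 0 0) * (((j' : GL (Fin 3) K) : Matrix (Fin 3) (Fin 3) K) 0 0) * E := by
  have hvϖ1 : Valued.v ϖ ≤ 1 := K2E3IwahoriTwoDepthFactorisation.v_uniformiser_le_one hvϖ
  obtain ⟨-, hY, -, hB, -, -, -⟩ := (K2E3IwahoriTwoDepthFactorisation.test_twoDepth_iff σ hvϖ1 r s r' s' j).1 ((hJg j).1 hj)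
  obtain ⟨-, -, -, -, hX, -, hZ⟩ := (K2E3IwahoriTwoDepthFactorisation.test_twoDepth_iff σ hvϖ1 r s r' s' j').1 ((hJg j').1 hj')
  have ha := K2E3IwahoriTwoDepthFactorisation.v_apply_zero_zero_eq_one_of_mem σ hJ hvσ hvϖ _ Jg hJg (by simpa using hr'1) (by simpa using hs'1) hj
  have ha' := K2E3IwahoriTwoDepthFactorisation.v_apply_zero_zero_eq_one_of_mem σ hJ hvσ hvϖ _ Jg hJg (by simpa using hr'1) (by simpa using hs'1) hj'
  -- names: row `0` of `j` is `(a, Y, B)`, column `0` of `j′` is `(a′, X, Z)`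
  set a : K := ((j : GL (Fin 3) K) : Matrix (Fin 3) (Fin 3) K) 0 0 with ha_def
  set Y : K := ((j : GL (Fin 3) K) : Matrix (Fin 3) (Fin 3) K) 0 1 with hY_def
  set B : K := ((j : GL (Fin 3) K) : Matrix (Fin 3) (Fin 3) K) 0 2 with hB_def
  set a' : K := ((j' : GL (Fin 3) K) : Matrix (Fin 3) (Fin 3) K) 0 0 with ha'_def
  set X : K := ((j' : GL (Fin 3) K) : Matrix (Fin 3) (Fin 3) K) 1 0 with hX_def
  set Z : K := ((j' : GL (Fin 3) K) : Matrix (Fin 3) (Fin 3) K) 2 0 with hZ_def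
  have ha0 : a ≠ 0 := fun h => by rw [h, map_zero] at ha; exact zero_ne_one ha
  have ha'0 : a' ≠ 0 := fun h => by rw [h, map_zero] at ha'; exact zero_ne_one ha'
  have hσa0 : σ a ≠ 0 := (map_ne_zero σ).2 ha0
  have hσa'0 : σ a' ≠ 0 := (map_ne_zero σ).2 ha'0
  -- normalised coordinates
  set y : K := Y / a with hy_def
  set b : K := B / a with hb_def
  set x : K := X / a' with hx_def
  set z : K := Z / a' with hz_def
  have hYe : Y = a * y := by rw [hy_def]; field_simp
  have hBe : B = a * b := by rw [hb_def]; field_simp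
  have hXe : X = a' * x := by rw [hx_def]; field_simp
  have hZe : Z = a' * z := by rw [hz_def]; field_simp
  -- isotropy, normalised: `σb = −yσy − b`, `σz = −xσx − z`
  have hrow := row_zero_isotropic σ hJ hσ j
  have hcol := col_zero_isotropic σ hJ j'
  rw [← ha_def, ← hY_def, ← hB_def] at hrow
  rw [← ha'_def, ← hX_def, ← hZ_def] at hcol
  have hσb : σ b = -(y * σ y) - b := by
    have h1 : a * σ a * (σ b + y * σ y + b) = 0 := by
      rw [hYe, hBe, map_mul, map_mul] at hrow; linear_combination hrow
    have h2 := (mul_eq_zero.1 h1).resolve_left (mul_ne_zero ha0 hσa0)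
    linear_combination h2
  have hσz : σ z = -(x * σ x) - z := by
    have h1 : a' * σ a' * (z + x * σ x + σ z) = 0 := by
      rw [hXe, hZe, map_mul, map_mul] at hcol; linear_combination hcol
    have h2 := (mul_eq_zero.1 h1).resolve_left (mul_ne_zero ha'0 hσa'0)
    linear_combination h2
  -- valuations of the normalised coordinates
  have hvy : Valued.v y ≤ Valued.v ϖ ^ r := by rw [hy_def, map_div₀, ha, div_one]; exact hY
  have hvb : Valued.v b ≤ Valued.v ϖ ^ s := by rw [hb_def, map_div₀, ha, div_one]; exact hB
  have hvx : Valued.v x ≤ Valued.v ϖ ^ r' := by rw [hx_def, map_div₀, ha', div_one]; exact hX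
  have hvz : Valued.v z ≤ Valued.v ϖ ^ s' := by rw [hz_def, map_div₀, ha', div_one]; exact hZ
  have hvσt : Valued.v (σ t) ≤ 1 := by rw [hvσ]; exact hvt
  -- the splitting
  refine ⟨t * (b * z) + σ (t * (b * z)), y * x - σ t * (y * σ y * (x * σ x) + y * σ y * z + b * (x * σ x)), ?_, ?_, ?_, ?_⟩
  · rw [map_add, hσ, add_comm]
  · refine Valuation.map_add_le _ ?_ ?_
    · rw [map_mul, map_mul, pow_add]
      exact (mul_le_of_le_one_left' hvt).trans (mul_le_mul' hvb hvz)
    · rw [hvσ, map_mul, map_mul, pow_add]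
      exact (mul_le_of_le_one_left' hvt).trans (mul_le_mul' hvb hvz)
  · have hpow : ∀ m : ℕ, n ≤ m → Valued.v ϖ ^ m ≤ Valued.v ϖ ^ n := fun m hm => pow_le_pow_right_of_le_one' hvϖ1 hm
    have hvyσy : Valued.v (y * σ y) ≤ Valued.v ϖ ^ (2 * r) := by
      rw [map_mul, hvσ, two_mul, pow_add]; exact mul_le_mul' hvy hvy
    have hvxσx : Valued.v (x * σ x) ≤ Valued.v ϖ ^ (2 * r') := by
      rw [map_mul, hvσ, two_mul, pow_add]; exact mul_le_mul' hvx hvx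
    refine Valuation.map_sub_le _ ?_ ?_
    · rw [map_mul]
      exact (mul_le_mul' hvy hvx).trans (by rw [← pow_add]; exact hpow _ hn1)
    · rw [map_mul]
      refine (mul_le_of_le_one_left' hvσt).trans (Valuation.map_add_le _ (Valuation.map_add_le _ ?_ ?_) ?_)
      · rw [map_mul]
        exact (mul_le_mul' hvyσy hvxσx).trans (by rw [← pow_add]; exact hpow _ (by omega))
      · rw [map_mul]
        exact (mul_le_mul' hvyσy hvz).trans (by rw [← pow_add]; exact hpow _ hn2)
      · rw [map_mul]
        exact (mul_le_mul' hvb hvxσx).trans (by rw [← pow_add]; exact hpow _ hn3)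
  · have hσt : σ t = 1 - t := by linear_combination ht
    rw [apply_zero_zero_mul_eq, ← ha_def, ← hY_def, ← hB_def, ← ha'_def, ← hX_def, ← hZ_def, hYe, hBe, hXe, hZe, map_mul, map_mul, hσb, hσz, hσt]
    ring

/-! ## §3 `θ(j) = χ₁(j₀₀)` is multiplicative on `J_{r,s;r',s'}` -/

include hJ hσ hvσ hvϖ hJg in
/-- **`θ(j) = χ₁(j₀₀)` IS MULTIPLICATIVE ON THE TWO-DEPTH GROUP `J_{r,s;r',s'}`** (`1 ≤ r'`, `1 ≤ s'`): for `χ₁ : Kˣ → ℂˣ` with `χ₁ = 1` on `{u : |u − 1| ≤ |ϖ|ⁿ}` (`hcond`) and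
on the `σ`-FIXED `u` with `|u − 1| ≤ |ϖ|ᶜ` (`hcondF`), depths with `n ≤ r + r'`, `n ≤ 2r + s'`, `n ≤ s + 2r'`, `c ≤ s + s'`, a trace-one `t` (`t + σt = 1`, `|t| ≤ 1`), and
`j, j′ ∈ J`: `χ₁((jj′)₀₀) = χ₁(j₀₀)·χ₁(j′₀₀)` — by §2, `(jj′)₀₀ = A + j₀₀j′₀₀E` with `A := j₀₀j′₀₀(1 + W)` a unit, `χ₁(1 + W) = 1` (`hcondF`), and ★ `chi_mk0_eq_mul_of_v_sub_le_pow`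
(`hcond`).  Roche's `χ̃` on `J_χ` read on the `(0,0)` entry; the two-depth replacement of ★ p861832 `chi_apply_zero_zero_mul_pow` in ★ V2b's letter `hθmul`.
[cite: Roche1998, §3, Lemma 3.2] [cite: MoyPrasad1996, §3] [cite: Casselman1995, §1.4] -/
theorem chi_apply_zero_zero_mul_twoDepth (hr'1 : 1 ≤ r') (hs'1 : 1 ≤ s') {n c : ℕ} (hn1 : n ≤ r + r') (hn2 : n ≤ 2 * r + s') (hn3 : n ≤ s + 2 * r')
    (hc : c ≤ s + s') (t : K) (ht : t + σ t = 1) (hvt : Valued.v t ≤ 1)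
    (χ₁ : Kˣ →* ℂˣ) (hcond : ∀ u : Kˣ, Valued.v ((u : K) - 1) ≤ Valued.v ϖ ^ n → χ₁ u = 1)
    (hcondF : ∀ u : Kˣ, σ (u : K) = u → Valued.v ((u : K) - 1) ≤ Valued.v ϖ ^ c → χ₁ u = 1)
    {j j' : ↥(unitaryGroupOfForm σ J)} (hj : j ∈ Jg) (hj' : j' ∈ Jg)
    (h0 : (((j * j' : ↥(unitaryGroupOfForm σ J)) : GL (Fin 3) K) : Matrix (Fin 3) (Fin 3) K) 0 0 ≠ 0)
    (h1 : (((j : GL (Fin 3) K) : Matrix (Fin 3) (Fin 3) K) 0 0) ≠ 0) (h2 : (((j' : GL (Fin 3) K) : Matrix (Fin 3) (Fin 3) K) 0 0) ≠ 0) :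
    χ₁ (Units.mk0 _ h0) = χ₁ (Units.mk0 _ h1) * χ₁ (Units.mk0 _ h2) := by
  have hvϖ1 : Valued.v ϖ ≤ 1 := K2E3IwahoriTwoDepthFactorisation.v_uniformiser_le_one hvϖ
  have hvϖlt : Valued.v ϖ < 1 := by rw [hvϖ, ← WithZero.exp_zero, WithZero.exp_lt_exp]; norm_num
  have ha := K2E3IwahoriTwoDepthFactorisation.v_apply_zero_zero_eq_one_of_mem σ hJ hvσ hvϖ _ Jg hJg (by simpa using hr'1) (by simpa using hs'1) hj
  have ha' := K2E3IwahoriTwoDepthFactorisation.v_apply_zero_zero_eq_one_of_mem σ hJ hvσ hvϖ _ Jg hJg (by simpa using hr'1) (by simpa using hs'1) hj'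
  obtain ⟨W, E, hσW, hvW, hvE, hsplit⟩ :=
    exists_fixed_add_small_of_mem σ hJ hσ hvσ hvϖ Jg hJg hr'1 hs'1 hn1 hn2 hn3 t ht hvt hj hj'
  -- `1 + W` is a `σ`-fixed unit congruent to `1` modulo `𝔭ᶜ`
  have hvW1 : Valued.v W < 1 :=
    hvW.trans_lt (pow_lt_one' hvϖlt (by omega))
  have hv1W : Valued.v (1 + W) = 1 := Valuation.map_one_add_of_lt _ hvW1
  have h1W0 : 1 + W ≠ 0 := fun h => by rw [h, map_zero] at hv1W; exact zero_ne_one hv1W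
  have hχW : χ₁ (Units.mk0 (1 + W) h1W0) = 1 := by
    refine hcondF _ (by rw [Units.val_mk0, map_add, map_one, hσW]) ?_
    rw [Units.val_mk0, add_sub_cancel_left]
    exact hvW.trans (pow_le_pow_right_of_le_one' hvϖ1 hc)
  -- the unit main term `A = j₀₀ j′₀₀ (1 + W)`
  have hA0 : (((j : GL (Fin 3) K) : Matrix (Fin 3) (Fin 3) K) 0 0) * (((j' : GL (Fin 3) K) : Matrix (Fin 3) (Fin 3) K) 0 0) * (1 + W) ≠ 0 :=
    mul_ne_zero (mul_ne_zero h1 h2) h1W0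
  have hvA : Valued.v ((((j : GL (Fin 3) K) : Matrix (Fin 3) (Fin 3) K) 0 0) * (((j' : GL (Fin 3) K) : Matrix (Fin 3) (Fin 3) K) 0 0) * (1 + W)) = 1 := by
    rw [map_mul, map_mul, ha, ha', hv1W, one_mul, one_mul]
  have hdiff : Valued.v ((((j * j' : ↥(unitaryGroupOfForm σ J)) : GL (Fin 3) K) : Matrix (Fin 3) (Fin 3) K) 0 0 -
      (((j : GL (Fin 3) K) : Matrix (Fin 3) (Fin 3) K) 0 0) * (((j' : GL (Fin 3) K) : Matrix (Fin 3) (Fin 3) K) 0 0) * (1 + W) * 1) ≤ Valued.v ϖ ^ n := by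
    rw [mul_one, hsplit, add_sub_cancel_left, map_mul, map_mul, ha, ha', one_mul, one_mul]
    exact hvE
  have step := K2E3LevelNIwahoriCharacter.chi_mk0_eq_mul_of_v_sub_le_pow χ₁ hcond hvA (map_one _) hdiff hA0 one_ne_zero h0
  rw [step, Units.mk0_one, map_one, mul_one, Units.mk0_mul, Units.mk0_mul, map_mul, map_mul, hχW, mul_one]

include hJ hσ hvσ hvϖ hJg in
/-- **The same at a place with `|2| = 1`** (`t := 2⁻¹`: `2⁻¹ + σ(2⁻¹) = 1`, `|2⁻¹| = 1`): `χ₁((jj′)₀₀) = χ₁(j₀₀)·χ₁(j′₀₀)` on `J_{r,s;r',s'}` under `hcond`, `hcondF` and the four depth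
inequalities. [cite: Roche1998, §3, Lemma 3.2] [cite: MoyPrasad1996, §3] -/
theorem chi_apply_zero_zero_mul_twoDepth_of_v_two (hr'1 : 1 ≤ r') (hs'1 : 1 ≤ s') {n c : ℕ} (hn1 : n ≤ r + r') (hn2 : n ≤ 2 * r + s')
    (hn3 : n ≤ s + 2 * r') (hc : c ≤ s + s') (h2v : Valued.v (2 : K) = 1)
    (χ₁ : Kˣ →* ℂˣ) (hcond : ∀ u : Kˣ, Valued.v ((u : K) - 1) ≤ Valued.v ϖ ^ n → χ₁ u = 1)
    (hcondF : ∀ u : Kˣ, σ (u : K) = u → Valued.v ((u : K) - 1) ≤ Valued.v ϖ ^ c → χ₁ u = 1)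
    {j j' : ↥(unitaryGroupOfForm σ J)} (hj : j ∈ Jg) (hj' : j' ∈ Jg)
    (h0 : (((j * j' : ↥(unitaryGroupOfForm σ J)) : GL (Fin 3) K) : Matrix (Fin 3) (Fin 3) K) 0 0 ≠ 0)
    (h1 : (((j : GL (Fin 3) K) : Matrix (Fin 3) (Fin 3) K) 0 0) ≠ 0) (h2 : (((j' : GL (Fin 3) K) : Matrix (Fin 3) (Fin 3) K) 0 0) ≠ 0) :
    χ₁ (Units.mk0 _ h0) = χ₁ (Units.mk0 _ h1) * χ₁ (Units.mk0 _ h2) := by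
  have h20 : (2 : K) ≠ 0 := fun h => by rw [h, map_zero] at h2v; exact zero_ne_one h2v
  refine chi_apply_zero_zero_mul_twoDepth σ hJ hσ hvσ hvϖ Jg hJg hr'1 hs'1 hn1 hn2 hn3 hc (2 : K)⁻¹ ?_ ?_ χ₁ hcond hcondF hj hj' h0 h1 h2
  · rw [map_inv₀, map_ofNat]; field_simp; norm_num
  · rw [map_inv₀, h2v, inv_one]

end Summit.HodgeConjecture.HodgeConjecture.Cruxes.H413.K2E3TwoDepthIwahoriCharacter

end
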